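import Summits.HodgeConjecture.HodgeConjecture.Theorems.H413TowerRealisationGlue
import Summits.HodgeConjecture.HodgeCM.Model.TowerAlgebra
import Summits.HodgeConjecture.CorCM.Hyp413.A3Liu413FaceTypes
import Literature.RepresentationTheory.Semisimple.EquivariantIrreducibleDecomposition
import HarnessLib

/-!
# FLOOR-0 P3, stub S1 — CLOSER: `StubS1HodgeMatsushimaDecAt` (Matsushima–Hodge realisation of the pin's `H¹_{B,τ'}(A_∞, ℂ)` by
# `(1,0) ⊕ (0,1)` cotangent automorphic forms), PROVED by its exact text

Cell hodgecm-mathlib (D-0151), FLOOR 0, crux item H413 = stmt-HodgeConjecture-24833; programme P3 «U3-mult», line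
`Cruxes/H413/Lines/F0_U3CohMultOne.lean` v1.1 (cf02d769) ∕ v1.2, registered stub `stub_S1_hodgeMatsushimaDecAt : StubS1HodgeMatsushimaDecAt`
(:163–171).  Author F0P3-p01 (g0).  `--supports stmt-HodgeConjecture-24833` (by-name fold `stub_S1_hodgeMatsushimaDecAt := F0P3StubS1Dec.stubS1_holds`
goes into the line at the registrar's next edition; Theorems may not import `Cruxes/…/Lines`, so the stub body is RESTATED VERBATIM as the type).

THE PROOF (joint desk P3-S1 ∕ P2-U1′ ∕ P4-T2, cell buses 21:50–22:05Z): at the pin (`4 ≤ [F:ℚ]` ⇒ `V` anisotropic, ★ `HermSpace3.isAnisotropic`),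
`(datum413 …).HB τ'` IS binder-1's tower `Tower … V = colim_K H¹(X_K(ℂ); ℂ)` at the records of record and `rhoB τ' = Representation.ofModule'`
acts by `act g = towerRep g` (★ `ofModule'_apply_eq_of_smul`, ★ `of_smul_eq_act`); the realisation `dec` is ★ `TowerRealisation.exists_realisation`:
levelwise Hodge decomposition `H¹ = F¹ ⊕ conj F¹` (★ `H413TowerRealisation`, F0P2-p04) of a family `c ∈ H_K`, INVERSE GLUING of the `(1,0)`-parts
into holomorphic cotangent automorphic forms (★ `F0P3TowerGlue`, this seat: `glue c x = (classPull c_{x_f}) (x_{ι₁})`, left `U(V)(F⁺)`-invariance from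
`c_h = t_γ^* c_{γ_f h}` and ★ `pull_trPull_apply`), `dec_Γ c := glue (π c) + conj (glue (π (conj c)))`, `Module.DirectLimit.lift`; injective by
the injectivity of the level class maps and ★ `disjoint_holCotForms_map_conjFun`; equivariant because re-indexing the family is right translation.
HC_CM is proved only modulo the printed citations until rung 0 closes; this file proves nothing about them.
[cite: BorelWallach2000, VII 3.2, VII 3.6, XIII 1.2] [cite: VoisinHodgeI2002, Cor. 7.6] [cite: Borel1997, §5.14] [cite: Liu2021, proof of Prop. 4.13, l. 2121–2131]

## References
* [BorelWallach2000] A. Borel, N. Wallach, *Continuous cohomology, discrete subgroups, and representations of reductive groups*, 2nd ed., AMS 2000,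
  VII 3.2, 3.6 (Matsushima's formula, Hodge types), XIII 1.2 (adelic pieces).
* [VoisinHodgeI2002] C. Voisin, *Hodge Theory and Complex Algebraic Geometry I*, CUP 2002, Cor. 7.6.  * [Borel1997] A. Borel, *Automorphic forms on SL₂(ℝ)*, §5.14.
* [Liu2021] Y. Liu, *Fourier–Jacobi cycles and arithmetic relative trace formula*, Camb. J. Math. 9 (2021), proof of Prop. 4.13, l. 2121–2131.
* Tree: ★ `Theorems/H413TowerRealisationGlue` ∕ `H413TowerRealisation` (F0P2-p04 (g0)), ★ `Theorems/F0P3TowerGlue` (this seat), ★ `Theorems/H413TowerConj`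
  (A-p19 (g15)), ★ `Theorems/H413CuspCot*` (A-p13 (g21)), ★ `CorCM/Hyp413/A3Liu413FaceTypes` (`datum413`), HodgeCM `Model/TowerAlgebra` (`of_smul_eq_act`).
-/

set_option autoImplicit false
set_option linter.dupNamespace false

noncomputable section

open NumberField NumberField.InfinitePlace
open HodgeCM HodgeCM.Model HodgeCM.Model.LiuIndex HodgeCM.Model.TowerCarrier
open Summit.HodgeConjecture.CorCM.Model
open Literature.AlgebraicGeometry.Motives (CMType)
open Literature.AlgebraicGeometry.HodgeTheory Literature.NumberTheory.Automorphic.PicardCM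
open Literature.AlgebraicGeometry.ShimuraVarieties Literature.AlgebraicGeometry.ShimuraVarieties.UnitaryCanonicalModel
open Literature.NumberTheory.ComplexMultiplication
open Literature.NumberTheory.Automorphic
open Literature.NumberTheory.Automorphic.Liu2021 Literature.NumberTheory.Automorphic.Liu2021.AppendixC
open Literature.NumberTheory.GelbartRogawski1991
open Summit.HodgeConjecture.CorCM Summit.HodgeConjecture.CorCM.Transposition
open Summit.HodgeConjecture.CorCM.Lines.A3Liu413 (datum413)
open Summit.HodgeConjecture.HodgeConjecture.Cruxes.H413.CohFormsCarriers

namespace Summit.HodgeConjecture.HodgeConjecture.Cruxes.H413.F0P3StubS1Dec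

set_option synthInstance.maxHeartbeats 400000 in
set_option maxHeartbeats 8000000 in
/-- **S1, PROVED — `StubS1HodgeMatsushimaDecAt` by its exact text**: for every face, if `3 ≤ n`, for every `τ'` there is an INJECTIVE `ℂ`-linear
`dec : H¹_{B,τ'}(A_∞, ℂ) → (U(V)(𝔸_{F⁺}) → ℂ²)` with values in `cohForms (archFactorOf F V)`, intertwining the pin's Hecke action `rhoB τ'` with the
finite-adelic right translation `rightRep F V`.  `stub_S1_hodgeMatsushimaDecAt := F0P3StubS1Dec.stubS1_holds` closes the registered stub by `exact`.
[cite: BorelWallach2000, VII 3.2, XIII 1.2] [cite: VoisinHodgeI2002, Cor. 7.6] [cite: Liu2021, proof of Prop. 4.13, l. 2121–2131] -/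
theorem stubS1_holds :
    ∀ (hDel : Literature.AlgebraicGeometry.ShimuraVarieties.UnitaryCanonicalModel.canonicalModel_exists_printed)
      (F : HodgeCM.CMField) [IsGalois ℚ F] (h6 : 6 ≤ Module.finrank ℚ F) {ι₁ : F →+* ℂ} (V : HodgeCM.HermSpace3 F ι₁) (a₀ : RealScalar F)
      (Φ : CMType F) (hΦ : ι₁ ∈ Φ.1) (i : (I V (repAt a₀) (muLiu ι₁ GramClass.rep))),
      3 ≤ (datum413 hDel F V a₀ Φ i).n → ∀ τ' : HodgeCM.CMField.K F →+* ℂ,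
        ∃ dec : (datum413 hDel F V a₀ Φ i).HB τ' →ₗ[ℂ] ((adelicDatum F V).Adelic → (Fin 2 → ℂ)),
          Function.Injective dec ∧ (∀ x, dec x ∈ cohForms (archFactorOf F V)) ∧
            ∀ (g : ↥(HodgeCM.HermSpace3.adelicFin V)) (x : (datum413 hDel F V a₀ Φ i).HB τ'),
              dec ((datum413 hDel F V a₀ Φ i).rhoB τ' g x) = rightRep F V g (dec x) := by
  intro hDel F _ h6 ι₁ V a₀ Φ _ i _ τ'
  have h4 : 4 ≤ Module.finrank ℚ F := le_trans (by norm_num) h6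
  have hV : IsAnisotropic F (HodgeCM.HermSpace3.Hm V) := HodgeCM.HermSpace3.isAnisotropic V h4
  obtain ⟨r, hinj, hmem, heqv⟩ := TowerRealisation.exists_realisation exists_isReal_hodgeModel_holds hodgePQ_independent_of_hodgeModel_holds
    Summit.HodgeConjecture.CorCM.BallQuotient.ballQuotientUniformised_holds
    (cmAbelianVarietyRealised_of_eigenbasis exists_isReal_hodgeModel_holds hodgePQ_independent_of_hodgeModel_holds
      Summit.HodgeConjecture.CorCM.cmAbelianVarietyEigenbasisRealised_holds)
    Literature.NumberTheory.Transcendental.arapura2012_cor_15_4_6_holds hV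
  refine ⟨r, hinj, hmem, fun g x => ?_⟩
  -- the pin's `rhoB τ' = Representation.ofModule'` acts on the tower by `of g • · = act g = towerRep g`
  have h2 : ∀ z : Tower exists_isReal_hodgeModel_holds hodgePQ_independent_of_hodgeModel_holds
      (ballQuotientUniformisedDatum_of Summit.HodgeConjecture.CorCM.BallQuotient.ballQuotientUniformised_holds)
      (cmAbelianVarietyRealised_of_eigenbasis exists_isReal_hodgeModel_holds hodgePQ_independent_of_hodgeModel_holds
        Summit.HodgeConjecture.CorCM.cmAbelianVarietyEigenbasisRealised_holds)
      Literature.NumberTheory.Transcendental.arapura2012_cor_15_4_6_holds V,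
      Representation.ofModule' (k := ℂ) (G := ↥(HodgeCM.HermSpace3.adelicFin V)) _ g z =
        act exists_isReal_hodgeModel_holds hodgePQ_independent_of_hodgeModel_holds
          (ballQuotientUniformisedDatum_of Summit.HodgeConjecture.CorCM.BallQuotient.ballQuotientUniformised_holds)
          (cmAbelianVarietyRealised_of_eigenbasis exists_isReal_hodgeModel_holds hodgePQ_independent_of_hodgeModel_holds
            Summit.HodgeConjecture.CorCM.cmAbelianVarietyEigenbasisRealised_holds)
          Literature.NumberTheory.Transcendental.arapura2012_cor_15_4_6_holds g z := fun z =>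
    (Literature.RepresentationTheory.Semisimple.ofModule'_apply_eq_of_smul (k := ℂ) (G := ↥(HodgeCM.HermSpace3.adelicFin V)) _ g z).trans
      (of_smul_eq_act _ _ _ _ _ g z)
  exact (congrArg r (h2 x)).trans (heqv g x)

end Summit.HodgeConjecture.HodgeConjecture.Cruxes.H413.F0P3StubS1Dec

end
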